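import Literature.Analysis.FluidPDE.SelfSimilar
import HarnessLib

/-!
# Tempered classical solutions of the linearised Navier–Stokes system; similarity generators

Let `E` be a finite-dimensional real inner product space (`E = ℝ³ = EuclideanSpace ℝ (Fin 3)` in
the applications) and let `u : ℝ → E → E` be a (smooth, ancient) velocity field on
`(-∞, 0) × E`, time first. The Navier–Stokes system `∂ₜu + (u·∇)u − Δu + ∇p = 0`, `div u = 0`
(viscosity normalised to `1`, as in Koch–Nadirashvili–Seregin–Šverák 2009, (1.1)), linearised
about `u`, is the system for a perturbation `(v, q) = (δu, δp)`
`∂ₜv + (u·∇)v + (v·∇)u = Δv − ∇q`, `div v = 0`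
(Doering–Gibbon 1995, §9.3, eq. (9.3.2): "the linearized evolution of `δu` about `u`";
§2.2, (2.2.8)–(2.2.9) for a stationary background).

This file provides

* `Literature.Analysis.FluidPDE.IsTemperedLinearisedNSSolution u v q`: `(v, q)` is a **classical**
  solution of the linearised system on `(-∞, 0) × E` (both fields jointly `C^∞` there, the
  equation and `div v = 0` pointwise for `t < 0`) with the **tempered** (scale-natural) growth
  `‖v(t, x)‖ ≤ K (1/√(-t) + (1 + ‖x‖)/(-t))`, `|q(t, x)| ≤ K (1/(-t) + (1 + ‖x‖)/(-t)^{3/2})`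
  for some `K`. This is exactly the growth of the *similarity Jacobi fields* of a Type I ancient
  solution `|u| ≤ C/√(-t)` (KNSS 2009, (1.4)–(1.6), and §1: scaling `u(x,t) ↦ λu(λx, λ²t)`,
  `p ↦ λ²p(λx, λ²t)`; Prop. 4.1: `t^{k/2+l} ∇ᵏ ∂ₜˡ u` bounded, whence `|∇u| ≲ 1/(-t)`,
  `|∂ₜu| ≲ (-t)^{-3/2}`, `|p| ≲ 1/(-t)`, `|∇p| ≲ (-t)^{-3/2}`): the translation fields `∂ᵢu`
  (`≲ 1/(-t)`), the rotation fields `(Ax)·∇u − Au` (`≲ ‖x‖/(-t) + 1/√(-t)`) and the scaling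
  field `u + x·∇u + 2t ∂ₜu` (`≲ 1/√(-t) + ‖x‖/(-t)`), with their pressures `a·∇p`, `(Ax)·∇p`,
  `2p + x·∇p + 2t∂ₜp` (`≲ 1/(-t) + ‖x‖ (-t)^{-3/2}`).
* `Literature.Analysis.FluidPDE.simGenerator a σ A u`: the infinitesimal generator
  `L_ξ u = ∇u·(a + σx + Ax) + σu + 2σt ∂ₜu − Au` of the similarity group
  `E ⋊ (ℝ₊ × SO(E))` (translations `x ↦ x + θa`, scalings `u ↦ λu(λ²t, λx)`, rotations
  `u ↦ R_θᵀ u(t, R_θ x)`, `R_θ = exp (θA)`, `A` skew) acting on velocity fields, at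
  `ξ = (a, σ, A)`; it is linear in `ξ` (`simGenerator_add`, `simGenerator_smul`) and vanishes on
  `u = 0`.
* the linear structure of the solution class (`IsTemperedLinearisedNSSolution.zero`, `.add`,
  `.smul`, `.neg`, `.sub`, `.sum`): tempered linearised solutions about a fixed `u` form a real
  vector space — no hypothesis on `u` is needed, since `u` enters the equation only through the
  linear maps `fderiv ℝ (u t) x` and the vectors `u t x`.

## Design notes

* Time derivative: the two-sided `Literature.Analysis.FluidPDE.timeDeriv` (Mathlib `deriv`);
  every `t < 0` is interior to the time domain, so for jointly smooth fields this is the honest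
  derivative (`IsTemperedLinearisedNSSolution.differentiableAt_time`).
* Smoothness is `Literature.Analysis.FluidPDE.IsSmoothSpaceTimeOn (Iio 0)`, i.e. *verbatim*
  `ContDiffOn ℝ ∞ (uncurry ·) (Iio 0 ×ˢ univ)`; `isTemperedLinearisedNSSolution_iff` unfolds the
  structure to the plain five-clause conjunction (the form in which route statements quote it),
  and the proof is by definitional unfolding only.
* `u` is a parameter without hypotheses: where `u t` is not differentiable, `fderiv ℝ (u t) x` is
  Mathlib's junk value `0`; the notion is meant for `u` smooth on `(-∞, 0) × E`.
* The growth constant `K` is existentially quantified and shared by `v` and `q`; the definition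
  does not impose `0 ≤ K`, but every witness satisfies it
  (`IsTemperedLinearisedNSSolution.exists_growth_nonneg`).
* Mathlib search (this pin): no Navier–Stokes notions (`NavierStokes`, `lineari[sz]ed`: none in
  `Mathlib/Analysis`); the tree has linearised systems only on the torus
  (`Literature.Analysis.FluidPDE.IsLinearizedNSSolutionOn`, corrector setting) and in vorticity
  form about a DSS orbit (`Literature.Analysis.FluidPDE.IsLinearisedVorticitySolution`), neither
  on `(-∞, 0) × E` with growth conditions.

## What is NOT here

No existence, uniqueness or Liouville statement for the linearised system, and no claim that the
Jacobi fields `simGenerator a σ A u` of an ancient Navier–Stokes solution are tempered linearised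
solutions (that needs the KNSS Prop. 4.1 bounds for `u` and its pressure and is route work, not
literature).

## References

* C. R. Doering, J. D. Gibbon, *Applied Analysis of the Navier–Stokes Equations*, CUP 1995,
  §2.2 (2.2.8)–(2.2.9), §9.3 (9.3.2).
* G. Koch, N. Nadirashvili, G. Seregin, V. Šverák, *Liouville theorems for the Navier–Stokes
  equations and applications*, Acta Math. 203 (2009), §1 (1.1), (1.4)–(1.6), Prop. 4.1.
-/

noncomputable section

open Set Function
open scoped ContDiff Laplacian InnerProductSpace RealInnerProductSpace

namespace Literature.Analysis.FluidPDE

/-! ### The similarity generator -/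

section SimGenerator

variable {E : Type*} [NormedAddCommGroup E] [NormedSpace ℝ E]

/-- The **infinitesimal similarity generator** applied to a velocity field `u : ℝ → E → E` at the
Lie-algebra element `ξ = (a, σ, A)` (`a : E` translation, `σ : ℝ` scaling rate, `A : E →L[ℝ] E`
rotation generator, skew in the applications):
`L_ξ u (t, x) = ∇u(t,x)·(a + σx + Ax) + σ u(t,x) + 2σt ∂ₜu(t,x) − A u(t,x)`,
the derivative at the identity of the one-parameter families `θ ↦ u(t, x + θa)`,
`λ ↦ λu(λ²t, λx)` (the Navier–Stokes scaling, KNSS 2009, §1) and `θ ↦ R_θᵀ u(t, R_θx)`,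
`R_θ = exp(θA)`, each of which maps Navier–Stokes solutions to Navier–Stokes solutions. Junk
value `0` of `fderiv`/`deriv` where `u` is not differentiable. [cite: KNSS2009, §1 (scaling symmetry)] -/
def simGenerator (a : E) (σ : ℝ) (A : E →L[ℝ] E) (u : ℝ → E → E) (t : ℝ) (x : E) : E :=
  fderiv ℝ (u t) x (a + σ • x + A x) + σ • u t x + (2 * σ * t) • timeDeriv u t x - A (u t x)

/-- Unfolding the similarity generator. [folklore] -/
@[simp]
theorem simGenerator_apply (a : E) (σ : ℝ) (A : E →L[ℝ] E) (u : ℝ → E → E) (t : ℝ) (x : E) :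
    simGenerator a σ A u t x =
      fderiv ℝ (u t) x (a + σ • x + A x) + σ • u t x + (2 * σ * t) • timeDeriv u t x
        - A (u t x) :=
  rfl

/-- The generator is **additive in the Lie-algebra element** `ξ = (a, σ, A)`:
`L_{ξ₁ + ξ₂} u = L_{ξ₁} u + L_{ξ₂} u` (linearity of `fderiv ℝ (u t) x` and of `A ↦ A v`). [folklore] -/
theorem simGenerator_add (a₁ a₂ : E) (σ₁ σ₂ : ℝ) (A₁ A₂ : E →L[ℝ] E) (u : ℝ → E → E) (t : ℝ)
    (x : E) :
    simGenerator (a₁ + a₂) (σ₁ + σ₂) (A₁ + A₂) u t x =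
      simGenerator a₁ σ₁ A₁ u t x + simGenerator a₂ σ₂ A₂ u t x := by
  simp only [simGenerator, FunLike.coe_add, Pi.add_apply, map_add, add_smul, add_mul,
    mul_add]
  abel

/-- The generator is **homogeneous in the Lie-algebra element**: `L_{cξ} u = c L_ξ u`. [folklore] -/
theorem simGenerator_smul (c : ℝ) (a : E) (σ : ℝ) (A : E →L[ℝ] E) (u : ℝ → E → E) (t : ℝ)
    (x : E) :
    simGenerator (c • a) (c * σ) (c • A) u t x = c • simGenerator a σ A u t x := by
  simp only [simGenerator, FunLike.coe_smul, Pi.smul_apply, map_add, map_smul, smul_add,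
    smul_sub, smul_smul]
  congr 1
  congr 1
  ring_nf

/-- At `ξ = 0` the generator vanishes. [folklore] -/
@[simp]
theorem simGenerator_zero_zero_zero (u : ℝ → E → E) (t : ℝ) (x : E) :
    simGenerator 0 0 0 u t x = 0 := by
  simp [simGenerator]

/-- The zero field is fixed by every similarity: `L_ξ 0 = 0` (sanity: the tangent space at the
trivial ancient solution carries no Jacobi fields). [folklore] -/
@[simp]
theorem simGenerator_zero_field (a : E) (σ : ℝ) (A : E →L[ℝ] E) (t : ℝ) (x : E) :
    simGenerator a σ A (0 : ℝ → E → E) t x = 0 := by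
  simp [simGenerator, timeDeriv]

/-- Pure translations: `L_{(a,0,0)} u = ∇u · a = ∂ₐ u`. [folklore] -/
theorem simGenerator_translation (a : E) (u : ℝ → E → E) (t : ℝ) (x : E) :
    simGenerator a 0 0 u t x = fderiv ℝ (u t) x a := by
  simp [simGenerator]

end SimGenerator

/-! ### Tempered classical solutions of the linearised system on `(-∞, 0) × E` -/

section Linearised

variable {E : Type*} [NormedAddCommGroup E] [InnerProductSpace ℝ E] [FiniteDimensional ℝ E]

/-- **Tempered classical solutions of the linearised Navier–Stokes system** about the velocity
field `u` on `(-∞, 0) × E`: the pair `(v, q)` (velocity perturbation, pressure perturbation) is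
jointly `C^∞` on `(-∞, 0) × E`, satisfies
`∂ₜv + (u·∇)v + (v·∇)u = Δv − ∇q`, `div v = 0` pointwise for `t < 0`
(the Navier–Stokes system with unit viscosity linearised about `u`; Doering–Gibbon 1995,
eq. (9.3.2)), and obeys the **tempered growth bounds**
`‖v(t,x)‖ ≤ K/√(-t) + K(1 + ‖x‖)/(-t)`, `|q(t,x)| ≤ K/(-t) + K(1 + ‖x‖)/√(-t)³` for some `K`
and all `t < 0`, `x` — the scale-natural growth of the similarity Jacobi fields
`simGenerator a σ A u` and their pressures when `u` is a Type I ancient solution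
(KNSS 2009, (1.4) and Prop. 4.1). No hypothesis on `u`. [cite: DoeringGibbon1995, §9.3 eq. (9.3.2)] -/
structure IsTemperedLinearisedNSSolution (u v : ℝ → E → E) (q : ℝ → E → ℝ) : Prop where
  /-- `v` is jointly `C^∞` on `(-∞, 0) × E`. -/
  smooth_velocity : IsSmoothSpaceTimeOn (Iio 0) v
  /-- `q` is jointly `C^∞` on `(-∞, 0) × E`. -/
  smooth_pressure : IsSmoothSpaceTimeOn (Iio 0) q
  /-- Tempered growth: `‖v‖ ≤ K/√(-t) + K(1+‖x‖)/(-t)` and `|q| ≤ K/(-t) + K(1+‖x‖)/√(-t)³`. -/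
  growth : ∃ K : ℝ, ∀ t < 0, ∀ x, ‖v t x‖ ≤ K / Real.sqrt (-t) + K * (1 + ‖x‖) / (-t) ∧
    |q t x| ≤ K / (-t) + K * (1 + ‖x‖) / Real.sqrt (-t) ^ 3
  /-- Incompressibility of the perturbation: `div v(t) = 0` for `t < 0`. -/
  divFree : ∀ t < 0, VectorCalculus.IsDivFree (v t)
  /-- The linearised momentum equation `∂ₜv + (u·∇)v + (v·∇)u = Δv − ∇q` for `t < 0`. -/
  momentum : ∀ t < 0, ∀ x,
    timeDeriv v t x + convect (u t) (v t) x + convect (v t) (u t) x = Δ (v t) x - gradient (q t) x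

variable {u v v₁ v₂ : ℝ → E → E} {q q₁ q₂ : ℝ → E → ℝ}

/-- Unfolding `IsTemperedLinearisedNSSolution` into the plain five-clause conjunction
(smoothness of `v`, of `q`, growth, `div v = 0`, momentum), with smoothness spelled
`ContDiffOn ℝ ⊤ (uncurry ·) (Iio 0 ×ˢ univ)`; both directions are definitional. [folklore] -/
theorem isTemperedLinearisedNSSolution_iff (u v : ℝ → E → E) (q : ℝ → E → ℝ) :
    IsTemperedLinearisedNSSolution u v q ↔
      ContDiffOn ℝ (⊤ : ℕ∞) (uncurry v) (Iio 0 ×ˢ univ) ∧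
      ContDiffOn ℝ (⊤ : ℕ∞) (uncurry q) (Iio 0 ×ˢ univ) ∧
      (∃ K : ℝ, ∀ t < 0, ∀ x, ‖v t x‖ ≤ K / Real.sqrt (-t) + K * (1 + ‖x‖) / (-t) ∧
        |q t x| ≤ K / (-t) + K * (1 + ‖x‖) / Real.sqrt (-t) ^ 3) ∧
      (∀ t < 0, VectorCalculus.IsDivFree (v t)) ∧
      (∀ t < 0, ∀ x, timeDeriv v t x + convect (u t) (v t) x + convect (v t) (u t) x =
        Δ (v t) x - gradient (q t) x) :=
  ⟨fun h => ⟨h.smooth_velocity, h.smooth_pressure, h.growth, h.divFree, h.momentum⟩,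
    fun h => ⟨h.1, h.2.1, h.2.2.1, h.2.2.2.1, h.2.2.2.2⟩⟩

/-! #### Regularity consequences -/

/-- The velocity slices `v t`, `t < 0`, are smooth. [folklore] -/
theorem IsTemperedLinearisedNSSolution.contDiff_velocity (h : IsTemperedLinearisedNSSolution u v q)
    {t : ℝ} (ht : t < 0) : ContDiff ℝ ∞ (v t) :=
  h.smooth_velocity.contDiff_slice ht

/-- The pressure slices `q t`, `t < 0`, are smooth. [folklore] -/
theorem IsTemperedLinearisedNSSolution.contDiff_pressure (h : IsTemperedLinearisedNSSolution u v q)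
    {t : ℝ} (ht : t < 0) : ContDiff ℝ ∞ (q t) :=
  h.smooth_pressure.contDiff_slice ht

/-- The time lines `s ↦ v s x` are differentiable at every `t < 0` (interior point of the time
domain), so `timeDeriv v t x` is an honest derivative. [folklore] -/
theorem IsTemperedLinearisedNSSolution.differentiableAt_time
    (h : IsTemperedLinearisedNSSolution u v q) {t : ℝ} (ht : t < 0) (x : E) :
    DifferentiableAt ℝ (fun s => v s x) t :=
  (h.smooth_velocity.differentiableWithinAt_time ht x).differentiableAt (Iio_mem_nhds ht)

/-- Every growth constant can be taken nonnegative — in fact any witness `K` is: evaluate the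
velocity bound at `t = -1`, `x = 0`. [folklore] -/
theorem IsTemperedLinearisedNSSolution.exists_growth_nonneg
    (h : IsTemperedLinearisedNSSolution u v q) :
    ∃ K : ℝ, 0 ≤ K ∧ ∀ t < 0, ∀ x, ‖v t x‖ ≤ K / Real.sqrt (-t) + K * (1 + ‖x‖) / (-t) ∧
      |q t x| ≤ K / (-t) + K * (1 + ‖x‖) / Real.sqrt (-t) ^ 3 := by
  obtain ⟨K, hK⟩ := h.growth
  refine ⟨K, ?_, hK⟩
  have h1 := (hK (-1) (by norm_num) 0).1
  have h0 : (0 : ℝ) ≤ ‖v (-1) 0‖ := norm_nonneg _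
  simp only [neg_neg, Real.sqrt_one, div_one, norm_zero, add_zero, mul_one] at h1
  linarith

/-! #### Linear structure of the solution class -/

section LaplacianZero

variable {F : Type*} [NormedAddCommGroup F] [NormedSpace ℝ F]

/-- `Δ 0 = 0` pointwise (Mathlib's basis formula for the Laplacian and
`iteratedFDeriv_zero_fun`). [folklore] -/
theorem laplacian_zero_apply (x : E) : Δ (0 : E → F) x = 0 := by
  rw [InnerProductSpace.laplacian_eq_iteratedFDeriv_orthonormalBasis (0 : E → F)
    (stdOrthonormalBasis ℝ E)]
  simp [Pi.zero_def]

end LaplacianZero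

/-- **The zero perturbation** `(v, q) = (0, 0)` is a tempered linearised solution about any
`u`. [folklore] -/
theorem IsTemperedLinearisedNSSolution.zero (u : ℝ → E → E) :
    IsTemperedLinearisedNSSolution u 0 0 where
  smooth_velocity := contDiffOn_const
  smooth_pressure := contDiffOn_const
  growth := ⟨0, fun t _ x => by simp⟩
  divFree t _ x := by simp [VectorCalculus.divergence]
  momentum t _ x := by
    simp [timeDeriv, convect, laplacian_zero_apply, gradient]

/-- **Scalar multiples**: `(c • v, c • q)` is a tempered linearised solution about `u` whenever
`(v, q)` is (growth constant `|c| K`). [folklore] -/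
theorem IsTemperedLinearisedNSSolution.smul (h : IsTemperedLinearisedNSSolution u v q) (c : ℝ) :
    IsTemperedLinearisedNSSolution u (c • v) (c • q) where
  smooth_velocity := h.smooth_velocity.const_smul c
  smooth_pressure := h.smooth_pressure.const_smul c
  growth := by
    obtain ⟨K, hK⟩ := h.growth
    refine ⟨|c| * K, fun t ht x => ?_⟩
    obtain ⟨hv, hq⟩ := hK t ht x
    constructor
    · calc ‖(c • v) t x‖ = |c| * ‖v t x‖ := by
            simp [norm_smul, Real.norm_eq_abs]
        _ ≤ |c| * (K / Real.sqrt (-t) + K * (1 + ‖x‖) / (-t)) :=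
            mul_le_mul_of_nonneg_left hv (abs_nonneg c)
        _ = |c| * K / Real.sqrt (-t) + |c| * K * (1 + ‖x‖) / (-t) := by ring
    · calc |(c • q) t x| = |c| * |q t x| := by
            simp [abs_mul]
        _ ≤ |c| * (K / (-t) + K * (1 + ‖x‖) / Real.sqrt (-t) ^ 3) :=
            mul_le_mul_of_nonneg_left hq (abs_nonneg c)
        _ = |c| * K / (-t) + |c| * K * (1 + ‖x‖) / Real.sqrt (-t) ^ 3 := by ring
  divFree t ht x := by
    have hd : DifferentiableAt ℝ (v t) x :=
      ((h.contDiff_velocity ht).differentiable (by simp)).differentiableAt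
    have h0 := h.divFree t ht x
    simp only [VectorCalculus.divergence] at h0 ⊢
    rw [show (c • v) t = c • v t from rfl, fderiv_const_smul hd c]
    simp [h0]
  momentum t ht x := by
    have hd : DifferentiableAt ℝ (v t) x :=
      ((h.contDiff_velocity ht).differentiable (by simp)).differentiableAt
    have hdq : DifferentiableAt ℝ (q t) x :=
      ((h.contDiff_pressure ht).differentiable (by simp)).differentiableAt
    have h2 : ContDiffAt ℝ 2 (v t) x :=
      (contDiff_infty.1 (h.contDiff_velocity ht) 2).contDiffAt
    have hdt := h.differentiableAt_time ht x
    have key := h.momentum t ht x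
    have e1 : timeDeriv (c • v) t x = c • timeDeriv v t x := by
      simp only [timeDeriv]
      exact deriv_const_smul c hdt
    have e2 : convect (u t) ((c • v) t) x = c • convect (u t) (v t) x := by
      simp only [convect]
      rw [show (c • v) t = c • v t from rfl, fderiv_const_smul hd c]
      rfl
    have e3 : convect ((c • v) t) (u t) x = c • convect (v t) (u t) x := by
      simp only [convect]
      rw [show (c • v) t x = c • v t x from rfl, map_smul]
    have e4 : Δ ((c • v) t) x = c • Δ (v t) x := by
      rw [show (c • v) t = c • v t from rfl, InnerProductSpace.laplacian_smul c h2]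
    have e5 : gradient ((c • q) t) x = c • gradient (q t) x := by
      rw [show (c • q) t = c • q t from rfl, gradient, gradient, fderiv_const_smul hdq c, map_smul]
    rw [e1, e2, e3, e4, e5, ← smul_add, ← smul_add, key, smul_sub]

/-- `∇(f + g) = ∇f + ∇g` at points of differentiability (Riesz isomorphism applied to
`fderiv_add`). [folklore] -/
theorem gradient_add_apply {f g : E → ℝ} {x : E} (hf : DifferentiableAt ℝ f x)
    (hg : DifferentiableAt ℝ g x) : gradient (f + g) x = gradient f x + gradient g x := by
  rw [gradient, gradient, gradient, fderiv_add hf hg, map_add]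

/-- **Sums**: `(v₁ + v₂, q₁ + q₂)` is a tempered linearised solution about `u` whenever
`(v₁, q₁)` and `(v₂, q₂)` are (growth constant `K₁ + K₂`). Uses only the linearity of the
equation in `(v, q)`; no hypothesis on `u`. [folklore] -/
theorem IsTemperedLinearisedNSSolution.add (h₁ : IsTemperedLinearisedNSSolution u v₁ q₁)
    (h₂ : IsTemperedLinearisedNSSolution u v₂ q₂) :
    IsTemperedLinearisedNSSolution u (v₁ + v₂) (q₁ + q₂) where
  smooth_velocity := h₁.smooth_velocity.add h₂.smooth_velocity
  smooth_pressure := h₁.smooth_pressure.add h₂.smooth_pressure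
  growth := by
    obtain ⟨K₁, hK₁⟩ := h₁.growth
    obtain ⟨K₂, hK₂⟩ := h₂.growth
    refine ⟨K₁ + K₂, fun t ht x => ?_⟩
    obtain ⟨hv₁, hq₁⟩ := hK₁ t ht x
    obtain ⟨hv₂, hq₂⟩ := hK₂ t ht x
    constructor
    · calc ‖(v₁ + v₂) t x‖ = ‖v₁ t x + v₂ t x‖ := rfl
        _ ≤ ‖v₁ t x‖ + ‖v₂ t x‖ := norm_add_le _ _
        _ ≤ (K₁ / Real.sqrt (-t) + K₁ * (1 + ‖x‖) / (-t)) +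
              (K₂ / Real.sqrt (-t) + K₂ * (1 + ‖x‖) / (-t)) := add_le_add hv₁ hv₂
        _ = (K₁ + K₂) / Real.sqrt (-t) + (K₁ + K₂) * (1 + ‖x‖) / (-t) := by ring
    · calc |(q₁ + q₂) t x| = |q₁ t x + q₂ t x| := rfl
        _ ≤ |q₁ t x| + |q₂ t x| := abs_add_le _ _
        _ ≤ (K₁ / (-t) + K₁ * (1 + ‖x‖) / Real.sqrt (-t) ^ 3) +
              (K₂ / (-t) + K₂ * (1 + ‖x‖) / Real.sqrt (-t) ^ 3) := add_le_add hq₁ hq₂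
        _ = (K₁ + K₂) / (-t) + (K₁ + K₂) * (1 + ‖x‖) / Real.sqrt (-t) ^ 3 := by ring
  divFree t ht x := by
    have hd₁ : DifferentiableAt ℝ (v₁ t) x :=
      ((h₁.contDiff_velocity ht).differentiable (by simp)).differentiableAt
    have hd₂ : DifferentiableAt ℝ (v₂ t) x :=
      ((h₂.contDiff_velocity ht).differentiable (by simp)).differentiableAt
    have e₁ := h₁.divFree t ht x
    have e₂ := h₂.divFree t ht x
    simp only [VectorCalculus.divergence] at e₁ e₂ ⊢
    rw [show (v₁ + v₂) t = v₁ t + v₂ t from rfl, fderiv_add hd₁ hd₂]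
    simp [e₁, e₂]
  momentum t ht x := by
    have hd₁ : DifferentiableAt ℝ (v₁ t) x :=
      ((h₁.contDiff_velocity ht).differentiable (by simp)).differentiableAt
    have hd₂ : DifferentiableAt ℝ (v₂ t) x :=
      ((h₂.contDiff_velocity ht).differentiable (by simp)).differentiableAt
    have hq₁' : DifferentiableAt ℝ (q₁ t) x :=
      ((h₁.contDiff_pressure ht).differentiable (by simp)).differentiableAt
    have hq₂' : DifferentiableAt ℝ (q₂ t) x :=
      ((h₂.contDiff_pressure ht).differentiable (by simp)).differentiableAt
    have h2₁ : ContDiffAt ℝ 2 (v₁ t) x :=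
      (contDiff_infty.1 (h₁.contDiff_velocity ht) 2).contDiffAt
    have h2₂ : ContDiffAt ℝ 2 (v₂ t) x :=
      (contDiff_infty.1 (h₂.contDiff_velocity ht) 2).contDiffAt
    have hdt₁ := h₁.differentiableAt_time ht x
    have hdt₂ := h₂.differentiableAt_time ht x
    have key₁ := h₁.momentum t ht x
    have key₂ := h₂.momentum t ht x
    have e1 : timeDeriv (v₁ + v₂) t x = timeDeriv v₁ t x + timeDeriv v₂ t x := by
      simp only [timeDeriv]
      exact deriv_add hdt₁ hdt₂
    have e2 : convect (u t) ((v₁ + v₂) t) x =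
        convect (u t) (v₁ t) x + convect (u t) (v₂ t) x := by
      simp only [convect]
      rw [show (v₁ + v₂) t = v₁ t + v₂ t from rfl, fderiv_add hd₁ hd₂]
      rfl
    have e3 : convect ((v₁ + v₂) t) (u t) x =
        convect (v₁ t) (u t) x + convect (v₂ t) (u t) x := by
      simp only [convect]
      rw [show (v₁ + v₂) t x = v₁ t x + v₂ t x from rfl, map_add]
    have e4 : Δ ((v₁ + v₂) t) x = Δ (v₁ t) x + Δ (v₂ t) x := by
      rw [show (v₁ + v₂) t = v₁ t + v₂ t from rfl, h2₁.laplacian_add h2₂]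
    have e5 : gradient ((q₁ + q₂) t) x = gradient (q₁ t) x + gradient (q₂ t) x := by
      rw [show (q₁ + q₂) t = q₁ t + q₂ t from rfl, gradient_add_apply hq₁' hq₂']
    rw [e1, e2, e3, e4, e5]
    calc timeDeriv v₁ t x + timeDeriv v₂ t x +
          (convect (u t) (v₁ t) x + convect (u t) (v₂ t) x) +
          (convect (v₁ t) (u t) x + convect (v₂ t) (u t) x)
        = (timeDeriv v₁ t x + convect (u t) (v₁ t) x + convect (v₁ t) (u t) x) +
            (timeDeriv v₂ t x + convect (u t) (v₂ t) x + convect (v₂ t) (u t) x) := by abel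
      _ = (Δ (v₁ t) x - gradient (q₁ t) x) + (Δ (v₂ t) x - gradient (q₂ t) x) := by
          rw [key₁, key₂]
      _ = Δ (v₁ t) x + Δ (v₂ t) x - (gradient (q₁ t) x + gradient (q₂ t) x) := by abel

/-- **Negatives**: `(-v, -q)` is a tempered linearised solution about `u` whenever `(v, q)` is. [folklore] -/
theorem IsTemperedLinearisedNSSolution.neg (h : IsTemperedLinearisedNSSolution u v q) :
    IsTemperedLinearisedNSSolution u (-v) (-q) := by
  have := h.smul (-1)
  rwa [neg_one_smul, neg_one_smul] at this

/-- **Differences**: `(v₁ - v₂, q₁ - q₂)` is a tempered linearised solution about `u` whenever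
`(v₁, q₁)` and `(v₂, q₂)` are. [folklore] -/
theorem IsTemperedLinearisedNSSolution.sub (h₁ : IsTemperedLinearisedNSSolution u v₁ q₁)
    (h₂ : IsTemperedLinearisedNSSolution u v₂ q₂) :
    IsTemperedLinearisedNSSolution u (v₁ - v₂) (q₁ - q₂) := by
  rw [sub_eq_add_neg, sub_eq_add_neg]
  exact h₁.add h₂.neg

/-- **Finite linear combinations** (pointwise form): if each `(vᵢ, qᵢ)`, `i ∈ s`, is a tempered
linearised solution about `u`, so is `(∑ cᵢ vᵢ, ∑ cᵢ qᵢ)` for any real coefficients `cᵢ` — the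
tempered linearised solutions about `u` form a real vector space. [folklore] -/
theorem IsTemperedLinearisedNSSolution.sum {ι : Type*} (s : Finset ι) {v : ι → ℝ → E → E}
    {q : ι → ℝ → E → ℝ} (h : ∀ i ∈ s, IsTemperedLinearisedNSSolution u (v i) (q i)) (c : ι → ℝ) :
    IsTemperedLinearisedNSSolution u (fun t x => ∑ i ∈ s, c i • v i t x)
      (fun t x => ∑ i ∈ s, c i * q i t x) := by
  classical
  have ev : (fun t x => ∑ i ∈ s, c i • v i t x) = ∑ i ∈ s, c i • v i := by
    ext t x
    simp [Finset.sum_apply]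
  have eq : (fun t x => ∑ i ∈ s, c i * q i t x) = ∑ i ∈ s, c i • q i := by
    ext t x
    simp [Finset.sum_apply]
  rw [ev, eq]
  clear ev eq
  induction s using Finset.induction_on with
  | empty => simpa using IsTemperedLinearisedNSSolution.zero u
  | insert i s hi ih =>
    rw [Finset.sum_insert hi, Finset.sum_insert hi]
    exact ((h i (Finset.mem_insert_self i s)).smul (c i)).add
      (ih fun j hj => h j (Finset.mem_insert_of_mem hj))

end Linearised

end Literature.Analysis.FluidPDE
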